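import Summits.BirchSwinnertonDyer.Rank1Residual.X11b.AnticyclotomicEmbedding
import Literature.NumberTheory.GaloisRepresentations.LocalGaloisGroupProofs
import Literature.NumberTheory.GaloisRepresentations.AbsGaloisRestrictSurjective
import Literature.NumberTheory.GaloisRepresentations.AbsGaloisGroupProofs
import Literature.NumberTheory.GaloisRepresentations.LocalKroneckerWeberInertiaProofs
import Literature.NumberTheory.Automorphic.AdicCompletionResidueCard
import HarnessLib

/-!
# The local Galois group at a prime of degree one: `Γ_{K_𝔭}` versus `Γ_{ℚ_v}`
# (crux `LocalTowerTorsionFiniteX3`, stmt-BirchSwinnertonDyer-19546 — FILE 3a of the hLine plan)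

Seat `bsd-schneider-door-c4` (cell `bsd-schneider-ideate`), gen 5; route `SchneiderFreeAdditiveX3`.
Number-field plumbing for the transport of «the canonical line with its character» from `(ℚ̄, D_v)` to
`(K̄, D_𝔭)` (sibling file `…LineCharacterBaseChange`): for a number field `K` and a prime `𝔭 ∣ v` of `K`
over a place `v` of `ℚ`, with `ι : ℚ_v → K_𝔭` the local base change (`adicCompletionOfLiesOver`),

* `exists_absGaloisRestrict_tower_eq_conj` — transitivity of the tree's restriction maps
  `absGaloisRestrict` up to ONE inner automorphism, for any tower of fields `F ⊆ E ⊆ L` (restriction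
  is defined through chosen embeddings of algebraic closures, unique up to conjugacy);
* `exists_absGaloisRestrict_adicCompletion_conj` — the two routes `Γ_{K_𝔭} → Γ_K → Γ_ℚ` and
  `Γ_{K_𝔭} → Γ_{ℚ_v} → Γ_ℚ` differ by a fixed conjugation `τ ∈ Γ_ℚ`;
* at DEGREE ONE (`e(𝔭|v) = f(𝔭|v) = 1`, so `ι` is onto): `Γ_{K_𝔭} → Γ_{ℚ_v}` is onto
  (`absGaloisRestrict_adicCompletion_surjective_of_degreeOne`), preserves Frobenius degrees
  (`isFrobPow_absGaloisRestrict_adicCompletion_of_inertiaDeg_eq_one`, `q_𝔭 = q_v`), and the two routes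
  carry the same `p`-adic cyclotomic character (`cyclotomicCharacter_adicCompletion_eq_of_conj`).

Proofs only (no definition, no named fact, no `sorry`); helper for stmt-BirchSwinnertonDyer-19546;
closes nothing by itself; BSD is not advanced.  References: [SerreAbelianLadic1968] Ch. I §2.1
(decomposition groups are well defined up to conjugacy); [TateCorvallis1979] §1.4 (1.4.5)–(1.4.6).
-/

noncomputable section

open scoped Classical

namespace Summit.BirchSwinnertonDyer.BirchSwinnertonDyer.Theorems.SchneiderFreeAdditiveX3

open NumberField IsDedekindDomain Field
  Literature.NumberTheory.EllipticCurves Literature.NumberTheory.EllipticCurves.GreenbergSelmer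
  Literature.NumberTheory.GaloisRepresentations Literature.NumberTheory.Automorphic
  Summit.BirchSwinnertonDyer.Rank1Residual.X11b

set_option linter.dupNamespace false

/-! ## §1. The local Galois group at a prime of degree one: `Γ_{K_𝔭}` versus `Γ_{ℚ_v}` -/

section Tower

/-- **Transitivity of restriction up to conjugacy** for a tower `F ⊆ E ⊆ L` of fields: the composite
`Γ_L → Γ_E → Γ_F` of the tree's restriction maps and `Γ_L → Γ_F` differ by an inner automorphism of
`Γ_F` (each restriction is defined through its own chosen embedding of algebraic closures, unique up
to conjugacy: `absGaloisRestrict_isConj_of_algHom_holds`).  Same statement and proof as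
`SorensenPatching.exists_absGaloisRestrict_absGaloisRestrict_eq_conj`, re-derived to keep this file's
imports light. [cite: SerreAbelianLadic1968, Ch. I §2.1] -/
theorem exists_absGaloisRestrict_tower_eq_conj (F E L : Type*) [Field F] [Field E] [Field L]
    [Algebra F E] [Algebra E L] [Algebra F L] [IsScalarTower F E L] :
    ∃ τ : absoluteGaloisGroup F, ∀ σ : absoluteGaloisGroup L,
      absGaloisRestrict F E (absGaloisRestrict E L σ) = τ * absGaloisRestrict F L σ * τ⁻¹ := by
  refine absGaloisRestrict_isConj_of_algHom_holds F L
    (((absClosureEmbedding E L).restrictScalars F).comp (absClosureEmbedding F E))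
    (fun σ => absGaloisRestrict F E (absGaloisRestrict E L σ)) (fun σ x => ?_)
  change absClosureEmbedding E L (absClosureEmbedding F E (_ • x)) =
    σ • absClosureEmbedding E L (absClosureEmbedding F E x)
  rw [absGaloisRestrict_apply_smul, absGaloisRestrict_apply_smul]

variable (K : Type) [Field K] [NumberField K] (v : HeightOneSpectrum (𝓞 ℚ))
  (𝔭 : HeightOneSpectrum (𝓞 K)) [h𝔭v : 𝔭.asIdeal.LiesOver v.asIdeal]

/-- `ℚ → ℚ_v → K_𝔭` is a scalar tower for the local base-change map `ι = adicCompletionOfLiesOver`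
(ring homomorphisms out of `ℚ` are unique). [folklore] -/
theorem isScalarTower_rat_adicCompletionOfLiesOver :
    letI := (adicCompletionOfLiesOver ℚ K v 𝔭).toAlgebra
    IsScalarTower ℚ (v.adicCompletion ℚ) (𝔭.adicCompletion K) := by
  letI := (adicCompletionOfLiesOver ℚ K v 𝔭).toAlgebra
  refine IsScalarTower.of_algebraMap_eq fun x => ?_
  exact RingHom.congr_fun (Subsingleton.elim (algebraMap ℚ (𝔭.adicCompletion K))
    ((algebraMap (v.adicCompletion ℚ) (𝔭.adicCompletion K)).comp
      (algebraMap ℚ (v.adicCompletion ℚ)))) x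

/-- **The two routes `Γ_{K_𝔭} → Γ_ℚ` are conjugate.**  For a prime `𝔭 ∣ v` of a number field `K`
the composites `Γ_{K_𝔭} → Γ_K → Γ_ℚ` and `Γ_{K_𝔭} → Γ_{ℚ_v} → Γ_ℚ` (the second along the local base
change `ι : ℚ_v → K_𝔭`) differ by one inner automorphism of `Γ_ℚ`.
[cite: SerreAbelianLadic1968, Ch. I §2.1] -/
theorem exists_absGaloisRestrict_adicCompletion_conj :
    letI := (adicCompletionOfLiesOver ℚ K v 𝔭).toAlgebra
    ∃ τ : absoluteGaloisGroup ℚ, ∀ σ : absoluteGaloisGroup (𝔭.adicCompletion K),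
      absGaloisRestrict ℚ K (absGaloisRestrict K (𝔭.adicCompletion K) σ) =
        τ * absGaloisRestrict ℚ (v.adicCompletion ℚ)
              (absGaloisRestrict (v.adicCompletion ℚ) (𝔭.adicCompletion K) σ) * τ⁻¹ := by
  letI := (adicCompletionOfLiesOver ℚ K v 𝔭).toAlgebra
  haveI := isScalarTower_rat_adicCompletionOfLiesOver K v 𝔭
  obtain ⟨τ₁, h₁⟩ := exists_absGaloisRestrict_tower_eq_conj ℚ K (𝔭.adicCompletion K)
  obtain ⟨τ₂, h₂⟩ :=
    exists_absGaloisRestrict_tower_eq_conj ℚ (v.adicCompletion ℚ) (𝔭.adicCompletion K)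
  refine ⟨τ₁ * τ₂⁻¹, fun σ => ?_⟩
  rw [h₁ σ, h₂ σ]
  group

/-- **At a prime of degree one `Γ_{K_𝔭} → Γ_{ℚ_v}` is onto**: `ι : ℚ_v → K_𝔭` is surjective
(`e(𝔭|v) f(𝔭|v) = [K_𝔭 : ℚ_v] = 1`, tree `surjective_adicCompletionOfLiesOver`), so `ℚ_v` is
algebraically closed in `K_𝔭` and `absGaloisRestrict_surjective_of_isIntegrallyClosedIn` applies.
[cite: SerreAbelianLadic1968, Ch. I §2.1] -/
theorem absGaloisRestrict_adicCompletion_surjective_of_degreeOne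
    (he : 𝔭.asIdeal.ramificationIdx (𝓞 ℚ) = 1) (hf : 𝔭.asIdeal.inertiaDeg (𝓞 ℚ) = 1) :
    letI := (adicCompletionOfLiesOver ℚ K v 𝔭).toAlgebra
    Function.Surjective (absGaloisRestrict (v.adicCompletion ℚ) (𝔭.adicCompletion K)) := by
  letI := (adicCompletionOfLiesOver ℚ K v 𝔭).toAlgebra
  have hsurj : Function.Surjective (algebraMap (v.adicCompletion ℚ) (𝔭.adicCompletion K)) :=
    surjective_adicCompletionOfLiesOver ℚ K v 𝔭 he hf
  haveI : CharZero (𝔭.adicCompletion K) :=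
    charZero_of_injective_algebraMap (algebraMap K (𝔭.adicCompletion K)).injective
  haveI : IsIntegrallyClosedIn (v.adicCompletion ℚ) (𝔭.adicCompletion K) :=
    isIntegrallyClosedIn_iff.mpr
      ⟨(algebraMap (v.adicCompletion ℚ) (𝔭.adicCompletion K)).injective, fun {x} _ => hsurj x⟩
  exact absGaloisRestrict_surjective_of_isIntegrallyClosedIn _ _

/-- **Equal residue cardinalities**: `q_{K_𝔭} = q_{ℚ_v}` when `f(𝔭|v) = 1`. [folklore] -/
theorem residueFieldCard_adicCompletion_eq_of_inertiaDeg_eq_one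
    (hf : 𝔭.asIdeal.inertiaDeg (𝓞 ℚ) = 1) :
    IsNonarchimedeanLocalField.residueFieldCard (𝔭.adicCompletion K) =
      IsNonarchimedeanLocalField.residueFieldCard (v.adicCompletion ℚ) := by
  rw [residueFieldCard_adicCompletion_eq, residueFieldCard_adicCompletion_eq,
    HeightOneSpectrum.residueCard_eq_card_quotient, HeightOneSpectrum.residueCard_eq_card_quotient,
    ← Submodule.cardQuot_apply, ← Submodule.cardQuot_apply, ← Ideal.absNorm_apply,
    ← Ideal.absNorm_apply]
  exact absNorm_eq_absNorm_of_inertiaDeg_eq_one ℚ K v 𝔭 hf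

/-- **Frobenius degrees are preserved** by `Γ_{K_𝔭} → Γ_{ℚ_v}` when `f(𝔭|v) = 1` (Tate's degree
scaling `IsFrobPow.absGaloisRestrict` with `q_{K_𝔭} = q_{ℚ_v}^1`). [cite: TateCorvallis1979, §1.4 (1.4.5)–(1.4.6)] -/
theorem isFrobPow_absGaloisRestrict_adicCompletion_of_inertiaDeg_eq_one
    (hf : 𝔭.asIdeal.inertiaDeg (𝓞 ℚ) = 1) {σ : absoluteGaloisGroup (𝔭.adicCompletion K)} {n : ℤ}
    (hσ : IsFrobPow σ n) :
    letI := (adicCompletionOfLiesOver ℚ K v 𝔭).toAlgebra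
    IsFrobPow (absGaloisRestrict (v.adicCompletion ℚ) (𝔭.adicCompletion K) σ) n := by
  letI := (adicCompletionOfLiesOver ℚ K v 𝔭).toAlgebra
  have hq : IsNonarchimedeanLocalField.residueFieldCard (𝔭.adicCompletion K) =
      IsNonarchimedeanLocalField.residueFieldCard (v.adicCompletion ℚ) ^ 1 := by
    rw [pow_one]; exact residueFieldCard_adicCompletion_eq_of_inertiaDeg_eq_one K v 𝔭 hf
  have h := IsFrobPow.absGaloisRestrict_holds (v.adicCompletion ℚ) hσ 1 hq
  simpa using h

omit h𝔭v in
/-- **The cyclotomic character along the two routes.**  If the two routes `Γ_{K_𝔭} → Γ_ℚ` differ by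
conjugation by `τ`, then `χ_p(res^K_𝔭 σ) = χ_p(res^ℚ_v (σ|_{ℚ̄_v}))` (`χ_p ∘ res^K_ℚ = χ_p`,
`cyclotomicCharacter_absGaloisRestrict`, and `χ_p` is a homomorphism to the commutative `ℤ_pˣ`).
[cite: SerreAbelianLadic1968, Ch. I §1.2] -/
theorem cyclotomicCharacter_adicCompletion_eq_of_conj (p : ℕ) [Fact p.Prime]
    [Algebra (v.adicCompletion ℚ) (𝔭.adicCompletion K)] {τ : absoluteGaloisGroup ℚ}
    (hτ : ∀ σ : absoluteGaloisGroup (𝔭.adicCompletion K),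
      absGaloisRestrict ℚ K (absGaloisRestrict K (𝔭.adicCompletion K) σ) =
        τ * absGaloisRestrict ℚ (v.adicCompletion ℚ)
              (absGaloisRestrict (v.adicCompletion ℚ) (𝔭.adicCompletion K) σ) * τ⁻¹)
    (σ : absoluteGaloisGroup (𝔭.adicCompletion K)) :
    GaloisRep.cyclotomicCharacter K p (absGaloisRestrict K (𝔭.adicCompletion K) σ) =
      GaloisRep.cyclotomicCharacter ℚ p (absGaloisRestrict ℚ (v.adicCompletion ℚ)
        (absGaloisRestrict (v.adicCompletion ℚ) (𝔭.adicCompletion K) σ)) := by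
  haveI : NeZero (p : ℚ) := ⟨by exact_mod_cast (Fact.out : p.Prime).ne_zero⟩
  rw [← cyclotomicCharacter_absGaloisRestrict ℚ K p, hτ σ, map_mul, map_mul, map_inv,
    mul_inv_cancel_comm]

end Tower

end Summit.BirchSwinnertonDyer.BirchSwinnertonDyer.Theorems.SchneiderFreeAdditiveX3

end
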